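import Literature.NumberTheory.EllipticCurves.HeegnerPointsKolyvaginPrimaryCebotarevFrobeniusProofs
import Literature.NumberTheory.EllipticCurves.SupersingularDensitySerreTraceProofs
import Literature.NumberTheory.EllipticCurves.GeomReductionFrobeniusProofs
import Literature.NumberTheory.EllipticCurves.LFunctionPrimeCoeff
import Literature.NumberTheory.Automorphic.ChebotarevArtinRepHolds
import Literature.NumberTheory.GaloisRepresentations.AbsGaloisOuterConj
import Literature.NumberTheory.GaloisRepresentations.IntegralGaloisActionProofs
import Literature.NumberTheory.DiophantineGeometry.LocalReductionFiniteBadPlacesProofs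
import Mathlib.Topology.Algebra.Group.ClosedSubgroup
import HarnessLib

/-!
# The Frobenius supply for `stub_chebotarevSupplyAtThree` (crux 19109, line `inert`; STUB-PLAN parts
# C4 and C3 (i)(ii)): a Frobenius `σ` near `σ₀` at a prime `𝔓 ∣ ℓ`, `ℓ` inert in `K`, `3 ∤ a_ℓ(E)`

Crux `stmt-BirchSwinnertonDyer-19109` (`EulerHalvesAtThree`), line `inert` (tam3-p1 g18, skeleton r19),
registered stub `stub_chebotarevSupplyAtThree`.  With NON-EMPTINESS (`…ChebSupplyNonempty`, p652012: an
element `σ₀` of the class) and the FROBENIUS DICTIONARY (`…ChebSupplyFrobenius`, p652633: the order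
condition at an arithmetic Frobenius near `σ₀`), this file supplies the Frobenius itself by density,
together with the two conclusions of the stub that are read directly at the prime: inertness and
`3 ∤ a_ℓ`.

* `primesEquiv_eq_of_natCast_mem'` — `primesEquiv u = p` for `p ∈ u` (plumbing);
* `ringHom_ringOfIntegers_rat_ext` — ring homomorphisms out of `𝓞 ℚ` agree (plumbing);
* `exists_isArithFrobAt_near` — **the Frobenius supply** (docstring there).

HONEST FRAMING: one part of one registered stub of one line of crux 19109; nothing about BSD for any curve
is proved here.

## References

* J.-P. Serre, *Abelian ℓ-adic representations and elliptic curves* (1968), Ch. I §2.2, Cor. 2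
  (density of Frobenius elements). [SerreAbelianLadic1968]
* J.-P. Serre, *Quelques applications du théorème de densité de Chebotarev*, Publ. Math. IHÉS 54 (1981),
  §8.1 (238). [Serre1981]
* J. Neukirch, *Algebraic Number Theory* (1999), Ch. I §9, Ch. VII §13. [NeukirchANT1999]

## Mathlib / tree search

Tree: `absoluteGaloisGroup.frobenius_dense`, `Automorphic.chebotarev_artinRep_holds`,
`index_range_absGaloisRestrict_eq_finrank`, `isClosed_range_absGaloisRestrict`,
`inertia_le_range_absGaloisRestrict_of_isUnramifiedIn`, `exists_place_inert_of_not_mem_range`,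
`span_natCast_eq_of_unique`, `span_natCast_rat_eq`, `HeightOneSpectrum.eq_of_natCast_mem_rat`,
`exists_prime_natCast_mem`, `finite_setOf_not_isUnramifiedIn`, `finite_badPlaces_holds`, `mem_badPlaces_iff`,
`hasGoodReductionAtPrime_primesEquiv_iff_holds`, `trace_galoisRepTorsion_frobenius_eq`,
`isOpen_ker_galoisRepTorsion_holds`, `absIntegers.isOpen_stabilizer`, `natCard_quotient_under_eq_of_mem_primesAbove`,
`absGaloisQuot_eq_one_iff`, `absEmbeddingInt`, `RingOfIntegers.dvd_norm` (Mathlib).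
Mathlib: `Subgroup.isOpen_of_isClosed_of_finiteIndex`, `Dense.inter_open_nonempty`, `isOpen_biInter_finset`,
`Ideal.finite_factors`, `Ideal.dvd_span_singleton`, `ZMod.intCast_zmod_eq_zero_iff_dvd`, `RingHom.ext_int`.
-/

noncomputable section

set_option autoImplicit false
set_option linter.dupNamespace false

open scoped NumberField Pointwise
open Field IsDedekindDomain NumberField WeierstrassCurve
open Literature.NumberTheory.GaloisRepresentations Literature.NumberTheory.EllipticCurves

namespace Summit.BirchSwinnertonDyer.BirchSwinnertonDyer.Theorems.ChebSupply

variable {K : Type} [Field K] [NumberField K]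

/-- `primesEquiv u = p` for a place `u` of `ℚ` containing the rational prime `p`. [folklore] -/
theorem primesEquiv_eq_of_natCast_mem' {u : HeightOneSpectrum (𝓞 ℚ)} {p : ℕ}
    (hp : p.Prime) (hu : (p : 𝓞 ℚ) ∈ u.asIdeal) : (Rat.HeightOneSpectrum.primesEquiv u : ℕ) = p := by
  have h1 : Rat.HeightOneSpectrum.natGenerator u ∣ p := by
    rw [Rat.HeightOneSpectrum.natGenerator_dvd_iff]
    have h2 := Ideal.mem_map_of_mem (Rat.IsIntegralClosure.intEquiv (𝓞 ℚ)) hu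
    rwa [map_natCast] at h2
  exact (Nat.prime_dvd_prime_iff_eq (Rat.HeightOneSpectrum.prime_natGenerator u) hp).mp h1

/-- Ring homomorphisms out of `𝓞 ℚ` agree. [folklore] -/
theorem ringHom_ringOfIntegers_rat_ext {R : Type*} [Semiring R] (f g : 𝓞 ℚ →+* R) : f = g := by
  have h : f.comp (Rat.ringOfIntegersEquiv.symm : ℤ →+* 𝓞 ℚ) =
      g.comp (Rat.ringOfIntegersEquiv.symm : ℤ →+* 𝓞 ℚ) := RingHom.ext_int _ _
  refine RingHom.ext fun x => ?_
  obtain ⟨n, rfl⟩ := Rat.ringOfIntegersEquiv.symm.surjective x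
  exact RingHom.congr_fun h n

/-- **The Frobenius supply** (STUB-PLAN C4 + C3 (i)(ii)).  Let `W/ℚ` be elliptic in global minimal
form, `K` quadratic, `σ₀ ∈ Γ_ℚ` with `σ₀ ∉ Gal(ℚ̄/e(K))` and `tr ρ̄_{E,3}(σ₀) ≠ 0` on `E[3]`.  For every
finite set `B ⊂ ℤ̄` of algebraic integers, every finite set `T` of rational primes and every finite set
`Y ⊂ 𝓞_K ∖ {0}` there are `σ ∈ Γ_ℚ`, a place `v` of `ℚ`, a prime `𝔓 ∣ v` of `ℤ̄` and a rational prime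
`ℓ` such that: `σ` agrees with `σ₀` on `B` and on `K` (`absGaloisQuot σ = absGaloisQuot σ₀`), `σ` is an
arithmetic Frobenius at `𝔓` (`IsArithFrobAt`), `ℓ ∈ v` is prime, `ℓ ∉ T`, `ℓ ≠ 3`,
`#(ℤ/𝔓 ∩ ℤ) = ℓ`, `ℓ ∈ 𝔓`, **`ℓ` is inert in `K`** (`(ℓ)` prime), **`3 ∤ a_ℓ(E)`**, and `e(y) ∉ 𝔓`
for all `y ∈ Y`.  Proof: the conditions "agrees with `σ₀` on `B`, on `K` (coset of the open subgroup
`Gal(ℚ̄/e(K))`, closed of index `2`) and on `E[3]` (coset of the open kernel of `ρ̄_{E,3}`,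
`isOpen_ker_galoisRepTorsion_holds`)" cut out an open neighbourhood of `σ₀`; Frobenius elements are
dense (`absoluteGaloisGroup.frobenius_dense` with the tree's `chebotarev_artinRep_holds`) off the
finite set of places over `T ∪ {2,3}`, ramified in `K`, of bad reduction, or dividing `N(y)`, `y ∈ Y`;
inertness is Step F of `HeegnerPointsKolyvaginPrimaryCebotarevFrobeniusProofs`
(`exists_place_inert_of_not_mem_range`); `3 ∤ a_ℓ` by `trace_galoisRepTorsion_frobenius_eq` (Serre 1981
(238)) since `ρ̄(σ) = ρ̄(σ₀)`; `e(y) ∉ 𝔓` because `y ∣ N(y)` (`RingOfIntegers.dvd_norm`) and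
`N(y) ∉ v`. [cite: SerreAbelianLadic1968, Ch. I §2.2 Cor. 2] [cite: Serre1981, §8.1 (238)]
[cite: NeukirchANT1999, Ch. I §9, Ch. VII §13 (Chebotarev)] -/
theorem exists_isArithFrobAt_near (W : WeierstrassCurve ℚ) [W.IsElliptic] [W.IsGloballyMinimal]
    [Algebra.IsQuadraticExtension ℚ K]
    {σ₀ : absoluteGaloisGroup ℚ} (hσ₀ : σ₀ ∉ (absGaloisRestrict ℚ K).range)
    (htr : letI : Module (ZMod 3) (geomTorsion W ((3 : ℕ) : ℤ)) := AddSubgroup.torsionBy.zmodModule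
      LinearMap.trace (ZMod 3) (geomTorsion W ((3 : ℕ) : ℤ))
        ((galoisRepTorsion W ((3 : ℕ) : ℤ) σ₀).toAdd.toAddMonoidHom.toZModLinearMap 3) ≠ 0)
    (B : Finset (absIntegers (𝓞 ℚ) ℚ)) (T : Finset ℕ) (Y : Finset (𝓞 K)) (hY : ∀ y ∈ Y, y ≠ 0) :
    ∃ (σ : absoluteGaloisGroup ℚ) (v : HeightOneSpectrum (𝓞 ℚ)) (𝔓 : Ideal (absIntegers (𝓞 ℚ) ℚ))
      (ℓ : ℕ), (∀ x ∈ B, σ • x = σ₀ • x) ∧ absGaloisQuot ℚ K σ = absGaloisQuot ℚ K σ₀ ∧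
      𝔓 ∈ v.primesAbove ∧ IsArithFrobAt (𝓞 ℚ) σ 𝔓 ∧ ℓ.Prime ∧ ℓ ∉ T ∧ ℓ ≠ 3 ∧
      Nat.card (𝓞 ℚ ⧸ 𝔓.under (𝓞 ℚ)) = ℓ ∧ (ℓ : absIntegers (𝓞 ℚ) ℚ) ∈ 𝔓 ∧
      (Ideal.span {(ℓ : 𝓞 K)}).IsPrime ∧ ¬ (3 : ℤ) ∣ W.frobeniusTrace ℓ ∧
      (∀ y ∈ Y, absEmbeddingInt ℚ K y ∉ 𝔓) := by
  classical
  letI : Module (ZMod 3) (geomTorsion W ((3 : ℕ) : ℤ)) := AddSubgroup.torsionBy.zmodModule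
  have h2 : Module.finrank ℚ K = 2 := Algebra.IsQuadraticExtension.finrank_eq_two ℚ K
  -- ### the finite exceptional set of places of `ℚ`
  set T' : Finset ℕ := T ∪ {2, 3} with hT'
  set S₁ : Set (HeightOneSpectrum (𝓞 ℚ)) := {v | ∃ p ∈ T', p.Prime ∧ (p : 𝓞 ℚ) ∈ v.asIdeal} with hS₁
  set S₂ : Set (HeightOneSpectrum (𝓞 ℚ)) := {v | ¬ Algebra.IsUnramifiedIn (𝓞 K) v.asIdeal} with hS₂
  set S₃ : Set (HeightOneSpectrum (𝓞 ℚ)) := W.badPlaces (𝓞 ℚ) with hS₃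
  set S₄ : Set (HeightOneSpectrum (𝓞 ℚ)) :=
    ⋃ y ∈ Y, {v | (RingOfIntegers.norm ℚ y : 𝓞 ℚ) ∈ v.asIdeal} with hS₄
  have hS₁fin : S₁.Finite := by
    have : S₁ ⊆ ⋃ p ∈ (T'.filter Nat.Prime), {v | (p : 𝓞 ℚ) ∈ v.asIdeal} := by
      intro v ⟨p, hpT, hp, hpv⟩
      simp only [Set.mem_iUnion, Finset.mem_filter]
      exact ⟨p, ⟨hpT, hp⟩, hpv⟩
    refine Set.Finite.subset (Set.Finite.biUnion (Finset.finite_toSet _) fun p hp ↦ ?_) this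
    rw [Finset.coe_filter, Set.mem_setOf_eq] at hp
    have hsub : {v : HeightOneSpectrum (𝓞 ℚ) | (p : 𝓞 ℚ) ∈ v.asIdeal}.Subsingleton :=
      fun v hv v' hv' ↦ HeightOneSpectrum.eq_of_natCast_mem_rat hp.2 hv hv'
    exact hsub.finite
  have hS₂fin : S₂.Finite := finite_setOf_not_isUnramifiedIn ℚ K
  have hS₃fin : S₃.Finite := W.finite_badPlaces_holds (𝓞 ℚ)
  have hS₄fin : S₄.Finite := by
    refine Set.Finite.biUnion (Finset.finite_toSet Y) fun y hy => ?_
    have hn0 : (RingOfIntegers.norm ℚ y : 𝓞 ℚ) ≠ 0 := by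
      intro h0
      have h1 : Algebra.norm ℚ ((y : 𝓞 K) : K) = 0 := by
        rw [← RingOfIntegers.coe_norm, h0]; rfl
      exact hY y hy (Subtype.ext (Algebra.norm_eq_zero_iff.mp h1))
    have hne : Ideal.span {(RingOfIntegers.norm ℚ y : 𝓞 ℚ)} ≠ 0 := by
      rw [Ne, Ideal.zero_eq_bot, Ideal.span_singleton_eq_bot]; exact hn0
    refine (Ideal.finite_factors hne).subset fun v hv => ?_
    rw [Set.mem_setOf_eq] at hv ⊢
    rw [Ideal.dvd_span_singleton]
    exact hv
  set S := S₁ ∪ S₂ ∪ S₃ ∪ S₄ with hSdef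
  have hSfin : S.Finite := ((hS₁fin.union hS₂fin).union hS₃fin).union hS₄fin
  -- ### the open neighbourhood of `σ₀`
  set H := (absGaloisRestrict ℚ K).range with hHdef
  have hHi : H.index = 2 := (index_range_absGaloisRestrict_eq_finrank ℚ K).trans h2
  haveI : H.FiniteIndex := ⟨by rw [hHi]; norm_num⟩
  have hHopen : IsOpen (H : Set (absoluteGaloisGroup ℚ)) :=
    H.isOpen_of_isClosed_of_finiteIndex (isClosed_range_absGaloisRestrict ℚ K)
  have hKer : IsOpen ((galoisRepTorsion W ((3 : ℕ) : ℤ)).ker : Set (absoluteGaloisGroup ℚ)) :=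
    W.isOpen_ker_galoisRepTorsion_holds (n := ((3 : ℕ) : ℤ)) (by norm_num)
  set O : Set (absoluteGaloisGroup ℚ) :=
    {σ | σ₀⁻¹ * σ ∈ H} ∩ {σ | σ₀⁻¹ * σ ∈ (galoisRepTorsion W ((3 : ℕ) : ℤ)).ker} ∩
      ⋂ x ∈ B, {σ | σ • x = σ₀ • x} with hOdef
  have hcont : Continuous fun σ : absoluteGaloisGroup ℚ => σ₀⁻¹ * σ := continuous_const_mul σ₀⁻¹
  have hOopen : IsOpen O := by
    refine (IsOpen.inter (hHopen.preimage hcont) (hKer.preimage hcont)).inter ?_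
    refine isOpen_biInter_finset fun x _ => ?_
    have hst := absIntegers.isOpen_stabilizer (𝓞 ℚ) (K := ℚ) x
    have heq : {σ : absoluteGaloisGroup ℚ | σ • x = σ₀ • x} =
        (fun σ => σ₀⁻¹ * σ) ⁻¹' (MulAction.stabilizer (absoluteGaloisGroup ℚ) x : Set _) := by
      ext σ
      simp only [Set.mem_setOf_eq, Set.mem_preimage, SetLike.mem_coe, MulAction.mem_stabilizer_iff,
        mul_smul, inv_smul_eq_iff]
    rw [heq]
    exact hst.preimage hcont
  have hσ₀O : σ₀ ∈ O := by
    refine ⟨⟨?_, ?_⟩, ?_⟩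
    · simp [inv_mul_cancel]
    · simp [inv_mul_cancel]
    · simp
  -- ### density of Frobenius elements
  obtain ⟨σ, hσO, v, hvS, 𝔓, h𝔓, hfrob⟩ :=
    (absoluteGaloisGroup.frobenius_dense Literature.NumberTheory.Automorphic.chebotarev_artinRep_holds ℚ S hSfin).inter_open_nonempty
      O hOopen ⟨σ₀, hσ₀O⟩
  obtain ⟨⟨hσH, hσker⟩, hσB⟩ := hσO
  simp only [Set.mem_iInter, Set.mem_setOf_eq] at hσB hσH hσker
  -- ### the prime `ℓ` under `v`
  obtain ⟨ℓ, hℓ, hℓv⟩ := exists_prime_natCast_mem v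
  have hℓT' : ℓ ∉ T' := fun h ↦ hvS (Or.inl (Or.inl (Or.inl ⟨ℓ, h, hℓ, hℓv⟩)))
  simp only [hT', Finset.mem_union, Finset.mem_insert, Finset.mem_singleton, not_or] at hℓT'
  obtain ⟨hℓT, hℓ2, hℓ3⟩ := hℓT'
  have hunr : Algebra.IsUnramifiedIn (𝓞 K) v.asIdeal := by
    by_contra h; exact hvS (Or.inl (Or.inl (Or.inr h)))
  have hgoodv : W.HasGoodReductionAt v := by
    by_contra h; exact hvS (Or.inl (Or.inr (show v ∈ W.badPlaces (𝓞 ℚ) from (mem_badPlaces_iff W v).mpr h)))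
  have hvS₄ : v ∉ S₄ := fun h ↦ hvS (Or.inr h)
  have hv : (Rat.HeightOneSpectrum.primesEquiv v : ℕ) = ℓ := primesEquiv_eq_of_natCast_mem' hℓ hℓv
  -- ### `σ` acts on `K` like `σ₀`
  have hquot : absGaloisQuot ℚ K σ = absGaloisQuot ℚ K σ₀ := by
    have h1 : absGaloisQuot ℚ K (σ₀⁻¹ * σ) = 1 := (absGaloisQuot_eq_one_iff ℚ K _).mpr hσH
    rw [map_mul, map_inv, inv_mul_eq_one] at h1
    exact h1.symm
  have hσr : σ ∉ (absGaloisRestrict ℚ K).range := by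
    intro h
    apply hσ₀
    rw [← absGaloisQuot_eq_one_iff] at h ⊢
    rw [← hquot, h]
  -- ### `ℓ` is inert (Step F of `HeegnerPointsKolyvaginPrimaryCebotarevFrobeniusProofs`)
  haveI hHn : ((absGaloisRestrict ℚ K).range).Normal :=
    Subgroup.normal_of_index_eq_two ((index_range_absGaloisRestrict_eq_finrank ℚ K).trans h2)
  have hI := inertia_le_range_absGaloisRestrict_of_isUnramifiedIn (K := K) hunr h𝔓
  obtain ⟨w, 𝔔, τ', hwv, hwuniq, -, h𝔔w, -, hτ', -⟩ :=
    exists_place_inert_of_not_mem_range (F := ℚ) (M := K) (h2 ▸ Nat.prime_two) hHn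
      ((index_range_absGaloisRestrict_eq_finrank ℚ K).trans rfl) hunr h𝔓 hI hfrob hσr
  have hℓw : (ℓ : 𝓞 K) ∈ w.asIdeal := by
    have h1 : (ℓ : 𝓞 ℚ) ∈ (w.under (𝓞 ℚ)).asIdeal := by rw [hwv]; exact hℓv
    rw [HeightOneSpectrum.under_asIdeal, Ideal.under_def, Ideal.mem_comap, map_natCast] at h1
    exact h1
  have hwuniq' : ∀ w' : HeightOneSpectrum (𝓞 K), (ℓ : 𝓞 K) ∈ w'.asIdeal → w' = w := by
    intro w' hw'
    apply hwuniq
    apply HeightOneSpectrum.eq_of_natCast_mem_rat hℓ _ hℓv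
    rw [HeightOneSpectrum.under_asIdeal, Ideal.under_def, Ideal.mem_comap, map_natCast]
    exact hw'
  have hspan : Ideal.span {(ℓ : 𝓞 K)} = w.asIdeal := by
    apply span_natCast_eq_of_unique hℓ w hwuniq'
    haveI : w.asIdeal.LiesOver v.asIdeal := ⟨by rw [← hwv]; rfl⟩
    have hmap : v.asIdeal.map (algebraMap (𝓞 ℚ) (𝓞 K)) = Ideal.span {(ℓ : 𝓞 K)} := by
      rw [← span_natCast_rat_eq hℓ hℓv, Ideal.map_span, Set.image_singleton, map_natCast]
    have hne : v.asIdeal.map (algebraMap (𝓞 ℚ) (𝓞 K)) ≠ ⊥ := by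
      rw [hmap, Ne, Ideal.span_singleton_eq_bot]; exact_mod_cast hℓ.ne_zero
    rw [← hmap, ← Ideal.IsDedekindDomain.ramificationIdx_eq_normalizedFactors_count v.asIdeal
      w.asIdeal hne]
    exact Ideal.ramificationIdx_eq_one_iff.mpr (hunr w.asIdeal w.isPrime inferInstance)
  -- ### residue characteristic, `ℓ ∈ 𝔓`
  have hq : Nat.card (𝓞 ℚ ⧸ 𝔓.under (𝓞 ℚ)) = ℓ :=
    natCard_quotient_under_eq_of_mem_primesAbove hv h𝔓
  have hℓ𝔓 : (ℓ : absIntegers (𝓞 ℚ) ℚ) ∈ 𝔓 := by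
    have h1 : (ℓ : 𝓞 ℚ) ∈ 𝔓.under (𝓞 ℚ) := by rw [← h𝔓.2.over]; exact hℓv
    rw [Ideal.under_def, Ideal.mem_comap, map_natCast] at h1
    exact h1
  -- ### `3 ∤ a_ℓ`: the trace of Frobenius on `E[3]`
  haveI : Fact ℓ.Prime := ⟨hℓ⟩
  have hgood : W.HasGoodReductionAtPrime ℓ :=
    (hasGoodReductionAtPrime_primesEquiv_iff_holds W v ℓ hv).mpr hgoodv
  have htrace := W.trace_galoisRepTorsion_frobenius_eq 3 hℓ3 hgood hv h𝔓 hfrob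
  have hρ : galoisRepTorsion W ((3 : ℕ) : ℤ) σ = galoisRepTorsion W ((3 : ℕ) : ℤ) σ₀ := by
    have h1 : galoisRepTorsion W ((3 : ℕ) : ℤ) (σ₀⁻¹ * σ) = 1 := hσker
    rw [map_mul, map_inv, inv_mul_eq_one] at h1
    exact h1.symm
  have haℓ : ¬ (3 : ℤ) ∣ W.frobeniusTrace ℓ := by
    intro hdvd
    apply htr
    rw [← hρ, htrace]
    exact (ZMod.intCast_zmod_eq_zero_iff_dvd _ 3).mpr (by exact_mod_cast hdvd)
  -- ### the norms avoid `𝔓`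
  have hnorm : ∀ y ∈ Y, absEmbeddingInt ℚ K y ∉ 𝔓 := by
    intro y hy hmem
    apply hvS₄
    simp only [hS₄, Set.mem_iUnion, Set.mem_setOf_eq]
    refine ⟨y, hy, ?_⟩
    haveI : IsGalois ℚ K := inferInstance
    obtain ⟨z, hz⟩ := RingOfIntegers.dvd_norm ℚ y
    have h1 : absEmbeddingInt ℚ K (algebraMap (𝓞 ℚ) (𝓞 K) (RingOfIntegers.norm ℚ y)) ∈ 𝔓 := by
      rw [hz, map_mul]
      exact Ideal.mul_mem_right _ _ hmem
    have h2 : (absEmbeddingInt ℚ K).comp (algebraMap (𝓞 ℚ) (𝓞 K)) =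
        algebraMap (𝓞 ℚ) (absIntegers (𝓞 ℚ) ℚ) := ringHom_ringOfIntegers_rat_ext _ _
    have h3 : algebraMap (𝓞 ℚ) (absIntegers (𝓞 ℚ) ℚ) (RingOfIntegers.norm ℚ y) ∈ 𝔓 := by
      rw [← h2]; exact h1
    rw [h𝔓.2.over]
    exact Ideal.mem_comap.mpr h3
  exact ⟨σ, v, 𝔓, ℓ, hσB, hquot, h𝔓, hfrob, hℓ, hℓT, hℓ3, hq, hℓ𝔓, hspan ▸ w.isPrime, haℓ, hnorm⟩

end Summit.BirchSwinnertonDyer.BirchSwinnertonDyer.Theorems.ChebSupply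

end
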